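import Summits.AnomalousDissipation.AnomalousDissipation.Theorems.SawtoothPulseCascadeK1LocalisedCascadeFibreData
import Summits.AnomalousDissipation.AnomalousDissipation.Theorems.SawtoothPulseCascadeK1LocalisedCascadeSpectralMoments
import Summits.AnomalousDissipation.AnomalousDissipation.Theorems.SawtoothPulseCascadeK1LocalisedCascadeSlotTaylorSymbol
import Summits.AnomalousDissipation.AnomalousDissipation.Theorems.SawtoothPulseCascadeK1LocalisedCascadeSlotWienerBound

/-!
# K1loc, line `Spectral` / SeqCone — helper: THE ONE-FAMILY FIBRE ESTIMATE FROM PROFILE DATA, SHARP WIENER WEIGHT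

Helper file of the prover lane on the crux `K1LocalisedCascade` (stmt-AnomalousDissipation-19491), route
`SawtoothPulseCascade` (variant of `…K1LocalisedCascadeFibreData`, asked for by the S-B constants lane ad-k1loc-p3,
STATUS 23:25:58Z).  `…FibreData` takes the spectral moments `Σ_q|q_j|^r‖𝓕Θ(q)‖` from `…SlotWienerBound`
(`≤ B_{r+2}/(12(2π)^r)`, TWO derivatives beyond `r`); at first order this asks for `D₃ = sup|X‴|`, whose only available bound
for the cascade cut-offs is `∝ (4πN_j/(δ_jε))³` — not summable over phases.  The sharper one-axis Sobolev–Wiener bound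
`…K1Slot.tsum_pow_abs_mul_norm_mFourierCoeff_le` (`≤ B_{r+1}/(2√3(2π)^r)`, ONE derivative beyond `r`) needs only `D₀..D_{r+1}`,
which are ε-free (`…FlatCurvatureCascade`, `…CutoffBoundSeq`).  This file is `fibre_estimate_one_family_of_fibre_data` with that
one lemma swapped (`fibre_estimate_one_family_of_fibre_data'`): constants
`A = Σ_{1≤α<r} B_α Cμ_α/(α!(2π)^α) + (Cμ_r/r!)·B_{r+1}/(2√3(2π)^r)`, `C = (CN_r/r!)·B_{r+1}/(2√3(2π)^r)`.
No definitions; no statement about the stub.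
[cite: Grafakos2014, Prop. 3.1.2 (5) and Prop. 3.2.7 (3)] [problem: turb]
-/

-- `Summit.<Summit>.<Problem>`: single-conjunct summit, the duplicate namespace segment is deliberate.
set_option linter.dupNamespace false

noncomputable section

namespace Summit.AnomalousDissipation.AnomalousDissipation.Theorems.SawtoothPulseCascade.K1Ledger

open MeasureTheory Set Filter Topology UnitAddTorus Complex
open scoped ComplexConjugate ContDiff Nat
open Literature.Analysis Literature.Analysis.FunctionSpaces Literature.Analysis.FunctionSpaces.Torus
open Summit.AnomalousDissipation.AnomalousDissipation.Theorems.SawtoothPulseCascade.SpectralLeakage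
open Summit.AnomalousDissipation.AnomalousDissipation.Theorems.SawtoothPulseCascade.K1Slot

variable {d : Type*} [Fintype d] [DecidableEq d]

/-- **The per-fibre estimate for one strip family from profile data — SHARP Wiener weight** (one derivative less).  As
`fibre_estimate_one_family_of_fibre_data`, with the spectral moments taken from
`…K1Slot.tsum_pow_abs_mul_norm_mFourierCoeff_le` (`Σ|q_j|^r‖𝓕Θ‖ ≤ B_{r+1}/(2√3(2π)^r)`, ad-k1loc-p3) instead of
`…SlotWienerBound` (`B_{r+2}/(12(2π)^r)`): at `r = 1` only `D₀, D₁, D₂` enter, which are ε-free for the cascade cut-offs.  As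
`fibre_estimate_one_family_of_data`, but the squared shifted new symbol is described through a FIBRE VERSION `m_n` of `m`
(`m_n = m` on the fibre `k_i = n`, `|m_n| ≤ M`, `m_n(k − b e_j)² = N(k_j)` for all `k`) — the usable form for symbols on `ℤ²`
that depend on both coordinates (take `m_n(k) = m(update k i n)`).  Fibre `k_i = n` (`i ≠ j`), smooth `G` on it; flat-strip
data of the multiplier (`P′ = s` on `U`, `X =ᶠ 0` off `U`, `|X| ≤ 1`, `|X^{(k)}| ≤ D_k`, shift `b`, zero profile `Z`); an order
`1 ≤ r`; the old symbol `μ` given on the fibre by a profile `Mμ ∈ C^r` (`μ(k) = Mμ(k_j)` when `k_i = n`, `|Mμ^{(α)}| ≤ Cμ_α` for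
`α ≤ r`); the new symbol `m` with `|m| ≤ M` and, on the fibre, `m(k − b e_j)² = N(k_j)` for a profile `N ∈ C^r` with
`|N^{(α)}| ≤ CN_α` (`α ≤ r`); and the branch compatibility `m(k − b e_j)² ≤ μ(k)²` on the fibre.  Then
`Σ' m²|𝓕((X(x_j)+Z(x_j))·G(Φ_P x))|² ≤ (√Σ' μ²|𝓕G|² + A·‖G‖)² + 2C·‖G‖²` with the explicit `A, C` of the module docstring.
[cite: Grafakos2014, Prop. 3.1.2 (5) and Prop. 3.2.7 (3)] -/
theorem fibre_estimate_one_family_of_fibre_data' {G : UnitAddTorus d → ℂ} {i j : d} (hG : IsSmooth G)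
    (hij : i ≠ j) {n : ℤ} (hn : ∀ k, mFourierCoeff G k ≠ 0 → k i = n) (P X Z : ShearProfile)
    (hX1 : ∀ y, |X y| ≤ 1) (hZ : ∀ y, Z y = 0) (b : ℤ)
    {U : Set ℝ} {s : ℝ} (hPU : ∀ y ∈ U, HasDerivAt P s y) (hXU : ∀ y, y ∉ U → (fun y : ℝ => (X y : ℂ)) =ᶠ[𝓝 y] 0)
    {D : ℕ → ℝ} (hD : ∀ k y, |iteratedDeriv k X y| ≤ D k)
    {r : ℕ} (hr : 1 ≤ r)
    {μ : (d → ℤ) → ℝ} {Mμ : ℝ → ℝ} (hMμc : ContDiff ℝ r Mμ) (hμM : ∀ k : d → ℤ, k i = n → μ k = Mμ (k j))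
    {Cμ : ℕ → ℝ} (hCμ : ∀ α ≤ r, ∀ t, |iteratedDeriv α Mμ t| ≤ Cμ α)
    {m mn : (d → ℤ) → ℝ} (hmn : ∀ k, k i = n → mn k = m k) {M : ℝ} (hmnM : ∀ k, |mn k| ≤ M)
    {N : ℝ → ℝ} (hNc : ContDiff ℝ r N) (hmN : ∀ k : d → ℤ, mn (k - Pi.single j b) ^ 2 = N (k j))
    {CN : ℕ → ℝ} (hCN : ∀ α ≤ r, ∀ t, |iteratedDeriv α N t| ≤ CN α)
    (hcomp : ∀ k : d → ℤ, k i = n → m (k - Pi.single j b) ^ 2 ≤ μ k ^ 2) :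
    ∑' k, m k ^ 2 * ‖mFourierCoeff (fun x => ((X.onCircle (x j) : ℂ) + Z.onCircle (x j)) * G (shearMap i j P x)) k‖ ^ 2 ≤
      (Real.sqrt (∑' k, μ k ^ 2 * ‖mFourierCoeff G k‖ ^ 2) +
          (∑ α ∈ Finset.Ico 1 r, (∑ i ∈ Finset.range (α + 1), (α.choose i : ℝ) * (2 * Real.pi * |(b : ℝ) - n * s|) ^ i *
              D (α - i)) * (Cμ α / ((α ! : ℝ) * (2 * Real.pi) ^ α)) +
            Cμ r / (r ! : ℝ) * ((∑ i ∈ Finset.range (r + 1 + 1), ((r + 1).choose i : ℝ) *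
              (2 * Real.pi * |(b : ℝ) - n * s|) ^ i * D (r + 1 - i)) / (2 * Real.sqrt 3 * (2 * Real.pi) ^ r))) *
            Real.sqrt (∫ x, ‖G x‖ ^ 2)) ^ 2 +
        2 * (CN r / (r ! : ℝ) * ((∑ i ∈ Finset.range (r + 1 + 1), ((r + 1).choose i : ℝ) *
              (2 * Real.pi * |(b : ℝ) - n * s|) ^ i * D (r + 1 - i)) / (2 * Real.sqrt 3 * (2 * Real.pi) ^ r))) * ∫ x, ‖G x‖ ^ 2 := by
  classical
  -- abbreviations
  set Θ : UnitAddTorus d → ℂ := fun x => (X.onCircle (x j) : ℂ) * twist P n (x j) * mFourier (Pi.single j b) x with hΘ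
  set Bv : ℕ → ℝ := fun α => ∑ i ∈ Finset.range (α + 1), (α.choose i : ℝ) * (2 * Real.pi * |(b : ℝ) - n * s|) ^ i *
    D (α - i) with hBv
  have hr0 : 0 < r := hr
  have hD0 : ∀ k, 0 ≤ D k := fun k => (abs_nonneg _).trans (hD k 0)
  have hBv0 : ∀ α, 0 ≤ Bv α := fun α => Finset.sum_nonneg fun i _ => by
    have := hD0 (α - i); positivity
  have hCμ0 : ∀ α ≤ r, 0 ≤ Cμ α := fun α hα => (abs_nonneg _).trans (hCμ α hα 0)
  have hCN0 : ∀ α ≤ r, 0 ≤ CN α := fun α hα => (abs_nonneg _).trans (hCN α hα 0)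
  -- (a) spectral moments from the bundle and the axis support
  obtain ⟨Θd, hsm, hcoef, h0, hBd⟩ := exists_multiplier_bundle X P n b hPU hXU hD j
  have hrel : ∀ α q, mFourierCoeff (Θd α) q = (2 * Real.pi * I * (q j : ℂ)) ^ α * mFourierCoeff (Θd 0) q :=
    fun α q => by rw [hcoef, h0]
  have haxis : ∀ (q : d → ℤ) (l : d), l ≠ j → q l ≠ 0 → mFourierCoeff (Θd 0) q = 0 := fun q l hl hq => by
    rw [h0]; exact mFourierCoeff_multiplier_eq_zero_of_ne X P n b j hl hq
  obtain ⟨hWs, hWle⟩ := tsum_pow_abs_mul_norm_mFourierCoeff_le j hr hrel haxis (hsm (r + 1)).continuous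
    (fun x => hBd (r + 1) x)
  rw [h0] at hWs hWle
  -- (b) Taylor data of the old fibre symbol
  set μn : (d → ℤ) → ℝ := fun k => Mμ (k j) with hμn
  set μd : ℕ → (d → ℤ) → ℂ := fun α k => (((iteratedDeriv α Mμ (k j) / (α ! : ℝ) : ℝ) : ℂ)) / (2 * Real.pi * I) ^ α
    with hμd
  have hμn_eq : ∀ k, k i = n → μn k = μ k := fun k hk => by rw [hμn]; exact (hμM k hk).symm
  have hμnM : ∀ k, |μn k| ≤ Cμ 0 := fun k => by
    have := hCμ 0 (Nat.zero_le _) (k j); simpa [hμn] using this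
  have hμd0 : ∀ k, μd 0 k = (μn k : ℂ) := fun k => by simp [hμd, hμn]
  have hMα : ∀ α ∈ Finset.range r, ∀ k, ‖μd α k‖ ≤ Cμ α / ((α ! : ℝ) * (2 * Real.pi) ^ α) := fun α hα k => by
    rw [hμd]; simp only; rw [norm_taylorCoeff]
    exact div_le_div_of_nonneg_right (hCμ α (Finset.mem_range.1 hα).le _) (by positivity)
  have hT : ∀ k q, mFourierCoeff Θ q ≠ 0 →
      ‖(μn k : ℂ) - ∑ α ∈ Finset.range r, (2 * Real.pi * I * (q j : ℂ)) ^ α * μd α (k - q)‖ ≤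
        Cμ r / (r ! : ℝ) * |((q j : ℤ) : ℝ)| ^ r := fun k q _ =>
    symbol_taylor_hT hMμc (hCμ r le_rfl) j (m := μn) (fun k => rfl) (md := μd) (fun α k => rfl) k q
  -- (c) Taylor data of the squared shifted new symbol
  set νd : ℕ → (d → ℤ) → ℂ := fun α k => (((iteratedDeriv α N (k j) / (α ! : ℝ) : ℝ) : ℂ)) / (2 * Real.pi * I) ^ α
    with hνd
  set Md : ℝ := ∑ α ∈ Finset.range r, CN α / ((α ! : ℝ) * (2 * Real.pi) ^ α) with hMd
  have hνdM : ∀ α ∈ Finset.range r, ∀ k, ‖νd α k‖ ≤ Md := fun α hα k => by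
    have hle : ‖νd α k‖ ≤ CN α / ((α ! : ℝ) * (2 * Real.pi) ^ α) := by
      rw [hνd]; simp only; rw [norm_taylorCoeff]
      exact div_le_div_of_nonneg_right (hCN α (Finset.mem_range.1 hα).le _) (by positivity)
    refine hle.trans ?_
    rw [hMd]
    exact Finset.single_le_sum (f := fun α => CN α / ((α ! : ℝ) * (2 * Real.pi) ^ α))
      (fun α' hα' => div_nonneg (hCN0 α' (Finset.mem_range.1 hα').le) (by positivity)) hα
  have hmshift : ∀ k : d → ℤ, mn (k + Pi.single j (-b)) ^ 2 = N (k j) := fun k => by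
    rw [show k + Pi.single j (-b) = k - Pi.single j b by rw [Pi.single_neg]; rfl]
    exact hmN k
  have hT₂ : ∀ k q, mFourierCoeff Θ q ≠ 0 →
      ‖((mn (k + Pi.single j (-b)) ^ 2 : ℝ) : ℂ) - ∑ α ∈ Finset.range r, (2 * Real.pi * I * (q j : ℂ)) ^ α * νd α (k - q)‖ ≤
        CN r / (r ! : ℝ) * |((q j : ℤ) : ℝ)| ^ r := fun k q _ =>
    symbol_taylor_hT hNc (hCN r le_rfl) j (m := fun k => mn (k + Pi.single j (-b)) ^ 2) hmshift (md := νd)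
      (fun α k => rfl) k q
  -- (d) the one-family estimate with these data
  have hmain := fibre_estimate_one_family_of_flat hG hij hn P X Z hX1 hZ b hPU hXU hD hr0 (m := m) (mn := mn)
    hmn hmnM hμn_eq hμnM hcomp hμd0 hMα hνdM
    (ρ := fun q => |((q j : ℤ) : ℝ)| ^ r) (ρ₂ := fun q => |((q j : ℤ) : ℝ)| ^ r)
    (fun q => by positivity) (fun q => by positivity)
    (div_nonneg (hCμ0 r le_rfl) (by positivity)) (div_nonneg (hCN0 r le_rfl) (by positivity)) hT hT₂ hWs hWs
  -- (e) weaken the spectral moments to the Wiener bound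
  refine hmain.trans ?_
  have hI : 0 ≤ ∫ x, ‖G x‖ ^ 2 := integral_nonneg fun x => by positivity
  have hsI : 0 ≤ Real.sqrt (∫ x, ‖G x‖ ^ 2) := Real.sqrt_nonneg _
  have hS0 : 0 ≤ Real.sqrt (∑' k, μ k ^ 2 * ‖mFourierCoeff G k‖ ^ 2) := Real.sqrt_nonneg _
  have hW0 : 0 ≤ ∑' q, |((q j : ℤ) : ℝ)| ^ r * ‖mFourierCoeff Θ q‖ := tsum_nonneg fun q => by positivity
  have hLμ : 0 ≤ Cμ r / (r ! : ℝ) := div_nonneg (hCμ0 r le_rfl) (by positivity)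
  have hLN : 0 ≤ CN r / (r ! : ℝ) := div_nonneg (hCN0 r le_rfl) (by positivity)
  have hsum0 : 0 ≤ ∑ α ∈ Finset.Ico 1 r, Bv α * (Cμ α / ((α ! : ℝ) * (2 * Real.pi) ^ α)) :=
    Finset.sum_nonneg fun α hα => mul_nonneg (hBv0 α)
      (div_nonneg (hCμ0 α (Finset.mem_Ico.1 hα).2.le) (by positivity))
  have hA : ∑ α ∈ Finset.Ico 1 r, Bv α * (Cμ α / ((α ! : ℝ) * (2 * Real.pi) ^ α)) +
      Cμ r / (r ! : ℝ) * ∑' q, |((q j : ℤ) : ℝ)| ^ r * ‖mFourierCoeff Θ q‖ ≤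
      ∑ α ∈ Finset.Ico 1 r, Bv α * (Cμ α / ((α ! : ℝ) * (2 * Real.pi) ^ α)) +
        Cμ r / (r ! : ℝ) * (Bv (r + 1) / (2 * Real.sqrt 3 * (2 * Real.pi) ^ r)) :=
    add_le_add le_rfl (mul_le_mul_of_nonneg_left hWle hLμ)
  have hC : CN r / (r ! : ℝ) * ∑' q, |((q j : ℤ) : ℝ)| ^ r * ‖mFourierCoeff Θ q‖ ≤
      CN r / (r ! : ℝ) * (Bv (r + 1) / (2 * Real.sqrt 3 * (2 * Real.pi) ^ r)) := mul_le_mul_of_nonneg_left hWle hLN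
  have hbase0 : 0 ≤ Real.sqrt (∑' k, μ k ^ 2 * ‖mFourierCoeff G k‖ ^ 2) +
      (∑ α ∈ Finset.Ico 1 r, Bv α * (Cμ α / ((α ! : ℝ) * (2 * Real.pi) ^ α)) +
        Cμ r / (r ! : ℝ) * ∑' q, |((q j : ℤ) : ℝ)| ^ r * ‖mFourierCoeff Θ q‖) * Real.sqrt (∫ x, ‖G x‖ ^ 2) := by
    positivity
  have hsq := pow_le_pow_left₀ hbase0 (add_le_add (le_refl (Real.sqrt (∑' k, μ k ^ 2 * ‖mFourierCoeff G k‖ ^ 2)))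
    (mul_le_mul_of_nonneg_right hA hsI)) 2
  have h2 := mul_le_mul_of_nonneg_right (mul_le_mul_of_nonneg_left hC (by norm_num : (0 : ℝ) ≤ 2)) hI
  simp only [hΘ, hBv] at hsq h2 ⊢
  linarith [hsq, h2]


end Summit.AnomalousDissipation.AnomalousDissipation.Theorems.SawtoothPulseCascade.K1Ledger
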